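import Literature.IUT.HodgeArakelov.RadialGraphsEx19iiiQuotProofs
import Literature.IUT.HodgeArakelov.AbsTopMonoidsNonVacuityAug
import Mathlib.Topology.Instances.ZMod
import Mathlib.RingTheory.RootsOfUnity.Complex

/-!
# [IUTchII] §1, Example 1.9 (iii): the named input "`Φ` fails to be full" is INDEPENDENT of the typed
# interfaces — a kernel NON-VACUITY / CONSISTENCY witness (the LIFT TOY)

S. Mochizuki, *Inter-universal Teichmüller theory II*, kurims manuscript (Dec. 2020), Example 1.9 (iii), p. 42
l. 54 – p. 43 l. 2: "The radial functor `Φ : ℛ → 𝒞` is defined via the assignment `Π ↦ Π/Δ` … Thus, `Φ` fails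
to be full [cf., e.g., [AbsTopIII], §I3; [AbsTopIII], Remark 1.9.1]. That is to say, `(ℛ, 𝒞, Φ)` is a
uniradial environment." Claim key `Mochizuki2012`, status DISPUTED (D-0012); record-only — nothing printed
is asserted here.

CONSISTENCY WITNESS, TOY (abc-iut cell, block C / W6, seat abc-iut-w6-d020; node **IUTchII:Ex1.9(iii)**):
consistency ≠ faithfulness. The node's one input is the NAMED PREDICATE
`quotientFunctor_not_full S Q := ¬ Q.Full` (plan/FACT-LIST F-0421), in print a citation to [AbsTopIII]
(non-"geometric" automorphisms of `G_k` exist, [NSW] Closing Remark before Thm 12.2.7, whereas automorphisms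
of `Π_X` rigidify `G_k`, Thm 1.9 / Cor 1.10 / Rmk 1.9.1). Over the cell's interfaces `ThetaSetting`
(`MonoThetaCyclotomes.lean`) and `AbsTopMonoids` (`AbsTopInterfaces.lean`, inhabited iff (H1) `Δ`
characteristic ∧ (H2) `Π^tp/Δ ≅ G_k`: `AbsTopMonoidsNonVacuity.lean`), with the GENUINE quotient functor
`AbsTopMonoids.quotFunctor` (`AbsTopQuotientMaps.lean`), this file shows that F-0421 is a genuine,
consistent, independent hypothesis:

* REALISED — the **lift toy** `liftSetting`: `Π^tp := ℤ` (discrete, written multiplicatively), `G := ℤ/5`,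
  `aug :=` reduction mod `5` (so `Δ = 5ℤ`), `k := ℂ`, `l := 3`, `p := 5`, trivial model environment. Here
  (H1) holds (`5ℤ = {x⁵}` is verbal, hence carried onto itself by every automorphism: `liftSetting_deltaX_char`),
  (H2) holds (`aug` is open onto the discrete `ℤ/5`: `AbsTopMonoids.quotDeltaX_iso_of_isOpenMap`), so the
  degenerate `AbsTopMonoids` of `AbsTopMonoidsNonVacuity` exists (`liftMonoids`), and
  **`quotientFunctor_not_full_lift`**: the quotient functor `Π ↦ Π/Δ` of the toy is NOT full — the
  automorphism `[x] ↦ [x]²` of `Π/Δ ≅ ℤ/5` (`liftSq`) is induced by NO automorphism of `Π = ℤ`, all of which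
  are `x ↦ x^{±1}` (`mulEquiv_int_apply`): `[1]² = [2] ≠ [±1]`. Hence (`ex19iii_lift_isUniradial`) the typed
  environment of Example 1.9 (iii) IS uniradial in the toy — the printed conclusion is realisable over the
  typed vocabulary with all interface laws holding jointly.
* REFUTED ELSEWHERE — the **point toy** `pointSetting` (`Π^tp = G := ℤ/1`): `G_k` trivial, so by
  `not_quotientFunctor_not_full_of_subsingleton` (p428047) EVERY `Q` is full (`not_quotientFunctor_not_full_point`).
* `quotientFunctor_not_full_independent` — both together: F-0421 is neither provable nor refutable from
  the interfaces; it is exactly the [AbsTopIII] content the node consumes BY NAME.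

What this does NOT show: anything about the real `Π^tp_{X̲̲_k} ↠ G_k` (there `Aut(G_k) ↚ Aut(Π)` is the
[NSW]/[AbsTopIII] phenomenon, layer L4, not in the FACT-LIST as a statement). Elementary group theory over
Mathlib (`Multiplicative ℤ`, `ZMod 5`, `QuotientGroup`); no instance declared; nothing here bears on
[IUTchIII] Cor. 3.12; no side taken. [claim: Mochizuki2012, status: disputed] (IUTchII §1 Ex 1.9 (iii), kurims pp.42-43)
-/

noncomputable section

namespace Literature.IUT.HodgeArakelov

namespace Ex19iiiToy

open CategoryTheory Multiplicative

/-! ## 1. The lift toy setting: `Π^tp := ℤ ↠ ℤ/5 =: G` -/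

/-- The augmentation of the lift toy: reduction mod `5`, `ℤ ↠ ℤ/5`, written multiplicatively.
[claim: Mochizuki2012, status: disputed] (IUTchII §1, kurims p.20) -/
def augFive : Multiplicative ℤ →* Multiplicative (ZMod 5) :=
  (Int.castAddHom (ZMod 5)).toMultiplicative

/-- `augFive` on `ofAdd n` is `ofAdd (n mod 5)`. [claim: Mochizuki2012, status: disputed] (IUTchII §1, kurims p.20) -/
theorem augFive_ofAdd (n : ℤ) : augFive (ofAdd n) = ofAdd (n : ZMod 5) := rfl

/-- `augFive` is surjective. [claim: Mochizuki2012, status: disputed] (IUTchII §1, kurims p.20) -/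
theorem augFive_surjective : Function.Surjective augFive := by
  intro y
  obtain ⟨n, hn⟩ := ZMod.intCast_surjective (toAdd y)
  exact ⟨ofAdd n, by rw [augFive_ofAdd, hn, ofAdd_toAdd]⟩

/-- The kernel of `augFive` is `5ℤ`: `n ∈ Ker ↔ 5 ∣ n`. [claim: Mochizuki2012, status: disputed] (IUTchII §1, kurims p.20) -/
theorem ofAdd_mem_ker_augFive_iff (n : ℤ) : ofAdd n ∈ augFive.ker ↔ (5 : ℤ) ∣ n := by
  rw [MonoidHom.mem_ker, augFive_ofAdd, ofAdd_eq_one]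
  exact_mod_cast ZMod.intCast_zmod_eq_zero_iff_dvd n 5

/-- The kernel of `augFive` is `5ℤ`: `x ∈ Ker ↔ 5 ∣ x`. [claim: Mochizuki2012, status: disputed] (IUTchII §1, kurims p.20) -/
theorem mem_ker_augFive_iff (x : Multiplicative ℤ) : x ∈ augFive.ker ↔ (5 : ℤ) ∣ toAdd x :=
  ofAdd_mem_ker_augFive_iff (toAdd x)

/-- **The lift toy `ThetaSetting`** ([IUTchII] §1 p. 20 interface): `N := 1`, `l := 3`, `p := 5`, `k := ℂ`
(`ζ₁₂ = e^{2πi/12}`), `Π^tp := ℤ` (discrete, multiplicative notation), `G := ℤ/5`, `aug :=` reduction mod 5,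
model `Π^tp_{Y̲}[μ_N] := ℤ/1` with `D := ⊤` and no theta subgroups. TOY — consistency, not faithfulness.
[claim: Mochizuki2012, status: disputed] (IUTchII §1, kurims p.20) -/
@[reducible] def liftSetting : ThetaSetting.{0} where
  N := 1
  l := 3
  l_prime := Nat.prime_three
  l_odd := by decide
  p := 5
  p_prime := Nat.prime_five
  p_odd := by decide
  p_ne_l := by decide
  k := ℂ
  hasPrimitiveRoot := ⟨Complex.exp (2 * Real.pi * Complex.I / (4 * 3 : ℕ)),
    Complex.isPrimitiveRoot_exp (4 * 3) (by decide)⟩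
  PiX := TopGroup.of (Multiplicative ℤ)
  Gk := TopGroup.of (Multiplicative (ZMod 5))
  aug := augFive
  aug_continuous := continuous_of_discreteTopology
  aug_surjective := augFive_surjective
  modelPi := TopGroup.of (Multiplicative (ZMod 1))
  modelD := ⊤
  modelD_inn := le_top
  modelD_continuous := fun _ _ => ⟨continuous_of_discreteTopology, continuous_of_discreteTopology⟩
  modelTheta := ∅

/-- In the lift toy, `Δ = Ker(aug) = 5ℤ`: `x ∈ Δ ↔ 5 ∣ x`. [claim: Mochizuki2012, status: disputed] (IUTchII §1, kurims p.20) -/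
theorem mem_deltaX_lift_iff (x : liftSetting.PiX) : x ∈ liftSetting.DeltaX ↔ (5 : ℤ) ∣ toAdd x :=
  mem_ker_augFive_iff x

/-- The automorphisms of the (multiplicatively written) group `ℤ` are `x ↦ x` and `x ↦ x⁻¹`: every
automorphism `g` satisfies `g(n) = n` for all `n` or `g(n) = −n` for all `n`. [folklore; plumbing for the toy]
[claim: Mochizuki2012, status: disputed] (IUTchII §1 Ex 1.9 (iii), kurims p.43) -/
theorem mulEquiv_int_apply (g : Multiplicative ℤ ≃* Multiplicative ℤ) :
    (∀ n : ℤ, g (ofAdd n) = ofAdd n) ∨ (∀ n : ℤ, g (ofAdd n) = ofAdd (-n)) := by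
  -- `g (ofAdd n) = ofAdd (n * a)` with `a := g(1)`
  set a : ℤ := toAdd (g (ofAdd 1)) with ha
  have hg : ∀ n : ℤ, g (ofAdd n) = ofAdd (n * a) := by
    intro n
    have h1 : g (ofAdd n) = (g (ofAdd 1)) ^ n := by
      rw [← map_zpow, ← ofAdd_zsmul, smul_eq_mul, mul_one]
    rw [h1, ← ofAdd_toAdd (g (ofAdd 1)), ← ha, ← ofAdd_zsmul, smul_eq_mul]
  -- surjectivity forces `a = ±1`
  obtain ⟨m, hm⟩ := g.surjective (ofAdd 1)
  have hm' : toAdd m * a = 1 := by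
    have := hg (toAdd m)
    rw [ofAdd_toAdd, hm] at this
    exact (ofAdd.injective this).symm
  have hunit : a = 1 ∨ a = -1 := by
    rcases Int.eq_one_or_neg_one_of_mul_eq_one' hm' with ⟨-, h⟩ | ⟨-, h⟩
    · exact Or.inl h
    · exact Or.inr h
  rcases hunit with h | h
  · exact Or.inl fun n => by rw [hg n, h, mul_one]
  · exact Or.inr fun n => by rw [hg n, h, mul_neg_one]

/-- (H1) for the lift toy: `Δ = 5ℤ` is carried onto itself by EVERY automorphism of the topological group
`Π^tp = ℤ` (it is the verbal subgroup of fifth powers). [claim: Mochizuki2012, status: disputed] (IUTchII §1 Ex 1.8 (i), kurims p.35) -/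
theorem liftSetting_deltaX_char (f : liftSetting.PiX ≃ₜ* liftSetting.PiX) :
    liftSetting.DeltaX.map f.toMulEquiv.toMonoidHom = liftSetting.DeltaX := by
  -- both inclusions from `f (ofAdd n) = ofAdd (± n)`
  have key : ∀ (g : Multiplicative ℤ ≃* Multiplicative ℤ) (x : Multiplicative ℤ),
      (5 : ℤ) ∣ toAdd x → (5 : ℤ) ∣ toAdd (g x) := by
    intro g x hx
    rcases mulEquiv_int_apply g with h | h
    · rw [← ofAdd_toAdd x, h, toAdd_ofAdd]; exact hx
    · rw [← ofAdd_toAdd x, h, toAdd_ofAdd]; exact (dvd_neg).2 hx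
  ext x
  rw [Subgroup.mem_map]
  constructor
  · rintro ⟨y, hy, rfl⟩
    rw [mem_deltaX_lift_iff] at hy ⊢
    exact key f.toMulEquiv y hy
  · intro hx
    rw [mem_deltaX_lift_iff] at hx
    refine ⟨f.toMulEquiv.symm x, ?_, MulEquiv.apply_symm_apply _ _⟩
    rw [mem_deltaX_lift_iff]
    exact key f.toMulEquiv.symm x hx

/-- (H2) for the lift toy: the augmentation `ℤ ↠ ℤ/5` is an open map (its codomain is discrete), so
`Π^tp/Δ ≅ G` as topological groups (`AbsTopMonoids.quotDeltaX_iso_of_isOpenMap`, abc-iut-w5-d105).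
[claim: Mochizuki2012, status: disputed] (IUTchII §1 Ex 1.8 (i), kurims p.35) -/
theorem liftSetting_aug_isOpenMap : IsOpenMap liftSetting.aug :=
  fun _ _ => isOpen_discrete _

/-- The lift toy's `AbsTopMonoids` (all monoids trivial; `Δ(Π*)` the transport of `Δ`; `Π*/Δ* ≅ G` through
(H2)): abc-iut-w5-d114's `AbsTopMonoids.degenerate` at (H1) `liftSetting_deltaX_char`, (H2)
`liftSetting_aug_isOpenMap`. [claim: Mochizuki2012, status: disputed] (IUTchII §1 Ex 1.8 (ii)-(ix), kurims pp.36-41) -/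
def liftMonoids : AbsTopMonoids liftSetting :=
  AbsTopMonoids.degenerate liftSetting_deltaX_char
    (AbsTopMonoids.quotDeltaX_iso_of_isOpenMap liftSetting liftSetting_aug_isOpenMap)

/-! ## 2. The non-liftable automorphism `[x] ↦ [x]²` of `Π/Δ ≅ ℤ/5` -/

/-- The reference object `Π := ℤ` of `IsoClass Π^tp` in the lift toy (= `IsoClass.base _`, spelled out so that
its carrier unfolds reducibly). [claim: Mochizuki2012, status: disputed] (IUTchII §1 Ex 1.8 (i), kurims p.35) -/
abbrev basePt : IsoClass liftSetting.PiX := ⟨liftSetting.PiX, ⟨ContinuousMulEquiv.refl _⟩⟩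

/-- `basePt` IS the reference object `IsoClass.base Π^tp`. [claim: Mochizuki2012, status: disputed]
(IUTchII §1 Ex 1.8 (i), kurims p.35) -/
theorem basePt_eq : basePt = IsoClass.base liftSetting.PiX := rfl

/-- At the reference object, `Δ(Π) = Δ = 5ℤ` (interface law `Delta_base`): `x ∈ Δ(Π) ↔ 5 ∣ x`.
[claim: Mochizuki2012, status: disputed] (IUTchII §1 Ex 1.8 (i), kurims p.35) -/
theorem mem_delta_basePt_iff (x : basePt.G) : x ∈ liftMonoids.Delta basePt ↔ (5 : ℤ) ∣ toAdd x :=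
  (SetLike.ext_iff.mp liftMonoids.Delta_base x).trans (mem_ker_augFive_iff x)

/-- In the lift toy, fifth powers die in `Π/Δ(Π)` at the reference object: `[y]⁵ = 1`.
[claim: Mochizuki2012, status: disputed] (IUTchII §1 Ex 1.9 (iii), kurims p.43) -/
theorem mk_pow_five (y : basePt.G) :
    (QuotientGroup.mk y : basePt.G ⧸ liftMonoids.Delta basePt) ^ 5 = 1 := by
  rw [← QuotientGroup.mk_pow, QuotientGroup.eq_one_iff, mem_delta_basePt_iff, toAdd_pow, nsmul_eq_mul,
    Nat.cast_ofNat]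
  exact Dvd.intro _ rfl

/-- Hence `x⁵ = 1` for every `x ∈ Π/Δ(Π)`. [claim: Mochizuki2012, status: disputed] (IUTchII §1 Ex 1.9 (iii), kurims p.43) -/
theorem quot_pow_five (x : basePt.G ⧸ liftMonoids.Delta basePt) : x ^ 5 = 1 := by
  induction x using QuotientGroup.induction_on with
  | H y => exact mk_pow_five y

/-- **The witness**: the automorphism `[x] ↦ [x]²` (inverse `[x] ↦ [x]³`, as `x⁵ = 1`) of the topological
group `Π/Δ(Π) ≅ ℤ/5`, as an automorphism of the object `Φ(Π) = Π/Δ` of `IsoClass G`.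
[claim: Mochizuki2012, status: disputed] (IUTchII §1 Ex 1.9 (iii), kurims p.43) -/
def liftSq :
    (⟨TopGroup.quot basePt.G (liftMonoids.Delta basePt), liftMonoids.quotIso basePt⟩ :
        IsoClass liftSetting.Gk) ⟶
      ⟨TopGroup.quot basePt.G (liftMonoids.Delta basePt), liftMonoids.quotIso basePt⟩ :=
  { toFun := fun x => x ^ 2
    invFun := fun x => x ^ 3
    left_inv := fun x => by
      show (x ^ 2) ^ 3 = x
      rw [← pow_mul]
      show x ^ (5 + 1) = x
      rw [pow_succ, quot_pow_five, one_mul]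
    right_inv := fun x => by
      show (x ^ 3) ^ 2 = x
      rw [← pow_mul]
      show x ^ (5 + 1) = x
      rw [pow_succ, quot_pow_five, one_mul]
    map_mul' := fun x y => mul_pow x y 2
    continuous_toFun := continuous_pow 2
    continuous_invFun := continuous_pow 3 }

/-- `liftSq [y] = [y]²`. [claim: Mochizuki2012, status: disputed] (IUTchII §1 Ex 1.9 (iii), kurims p.43) -/
theorem liftSq_mk (y : basePt.G) :
    IsoClass.homIso liftSq (QuotientGroup.mk y : basePt.G ⧸ liftMonoids.Delta basePt) =
      (QuotientGroup.mk y : basePt.G ⧸ liftMonoids.Delta basePt) ^ 2 := rfl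

/-- In `Π/Δ ≅ ℤ/5`: `[1]² = [2] ≠ [1]` and `≠ [−1]`.
[claim: Mochizuki2012, status: disputed] (IUTchII §1 Ex 1.9 (iii), kurims p.43) -/
theorem mk_one_sq_ne_mk (ε : ℤ) (hε : ε = 1 ∨ ε = -1) :
    (QuotientGroup.mk (ofAdd (1 : ℤ)) : basePt.G ⧸ liftMonoids.Delta basePt) ^ 2 ≠
      QuotientGroup.mk (ofAdd ε) := by
  intro h
  rw [← QuotientGroup.mk_pow] at h
  have h' := (mem_delta_basePt_iff _).mp (QuotientGroup.eq.mp h)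
  simp only [toAdd_mul, toAdd_inv, toAdd_pow, nsmul_eq_mul, Nat.cast_ofNat] at h'
  -- `toAdd (ofAdd 1) = 1` definitionally
  have h'' : (5 : ℤ) ∣ -(2 * 1) + ε := h'
  rcases hε with rfl | rfl <;> omega

/-- **NON-VACUITY of F-0421 at the genuine quotient functor**: in the lift toy the quotient functor
`Π ↦ Π/Δ` is NOT full — `liftSq` is induced by no automorphism of `Π = ℤ` (these are `x ↦ x^{±1}`, inducing
`[x] ↦ [x]^{±1} ≠ [x]²` at `x = 1`). Via `AbsTopMonoids.quotientFunctor_not_full_quot_of_aut` (p428638).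
[claim: Mochizuki2012, status: disputed] (IUTchII §1 Ex 1.9 (iii), kurims pp.42-43) -/
theorem quotientFunctor_not_full_lift :
    Literature.IUT.HodgeArakelov.quotientFunctor_not_full liftSetting liftMonoids.quotFunctor := by
  refine liftMonoids.quotientFunctor_not_full_quot_of_aut basePt liftSq fun f => ⟨ofAdd (1 : ℤ), ?_⟩
  intro h
  -- `liftSq [1] = [1]²` definitionally
  have h2 : (QuotientGroup.mk (ofAdd (1 : ℤ)) : basePt.G ⧸ liftMonoids.Delta basePt) ^ 2 =
      QuotientGroup.mk (IsoClass.homIso f (ofAdd (1 : ℤ))) := h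
  rcases mulEquiv_int_apply (IsoClass.homIso f).toMulEquiv with hf | hf
  · have h1 : IsoClass.homIso f (ofAdd (1 : ℤ)) = ofAdd (1 : ℤ) := hf 1
    exact mk_one_sq_ne_mk 1 (Or.inl rfl) (h2.trans (by rw [h1]))
  · have h1 : IsoClass.homIso f (ofAdd (1 : ℤ)) = ofAdd (-1 : ℤ) := hf 1
    exact mk_one_sq_ne_mk (-1) (Or.inr rfl) (h2.trans (by rw [h1]))

/-- Hence, in the lift toy, the typed radial environment of **IUTchII:Ex1.9(iii)** at the genuine quotient
functor IS uniradial — the printed "That is to say, `(ℛ, 𝒞, Φ)` is a uniradial environment" is REALISABLE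
over the typed vocabulary with every interface law holding jointly (consistency, not faithfulness).
[claim: Mochizuki2012, status: disputed] (IUTchII §1 Ex 1.9 (iii), kurims p.43) -/
theorem ex19iii_lift_isUniradial :
    (@Literature.IUT.HodgeArakelov.ex19iii liftSetting liftMonoids.quotFunctor
      liftMonoids.quotFunctor_essSurj).IsUniradial :=
  (@ex19iii_isUniradial_iff liftSetting liftMonoids.quotFunctor liftMonoids.quotFunctor_essSurj).2
    quotientFunctor_not_full_lift

/-- … and every functorial algorithm `Ξ` on `IsoClass Π^tp` of the lift toy is uniradially defined through it
(the landed `ex19iii_uniradiallyDefined`, its hypothesis now DISCHARGED in the toy).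
[claim: Mochizuki2012, status: disputed] (IUTchII §1 Ex 1.9 (iii), kurims p.43) -/
theorem ex19iii_lift_uniradiallyDefined {F : Type} [Category.{0} F]
    (Ξ : IsoClass liftSetting.PiX ⥤ F) :
    ((@Literature.IUT.HodgeArakelov.ex19iii liftSetting liftMonoids.quotFunctor
      liftMonoids.quotFunctor_essSurj).toDagger Ξ).IsUniradiallyDefined :=
  @Literature.IUT.HodgeArakelov.ex19iii_uniradiallyDefined liftSetting liftMonoids.quotFunctor
    liftMonoids.quotFunctor_essSurj quotientFunctor_not_full_lift F _ Ξ

/-! ## 3. The point toy: `G` trivial, every `Φ` full -/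

/-- **The point toy `ThetaSetting`**: `Π^tp = G := ℤ/1`, `aug := 1`, `k := ℂ`, `l := 3`, `p := 5`, trivial model
environment (the shape of abc-iut-w5-d243's cyclic toy setting, with `Π := 1`).
[claim: Mochizuki2012, status: disputed] (IUTchII §1, kurims p.20) -/
@[reducible] def pointSetting : ThetaSetting.{0} where
  N := 1
  l := 3
  l_prime := Nat.prime_three
  l_odd := by decide
  p := 5
  p_prime := Nat.prime_five
  p_odd := by decide
  p_ne_l := by decide
  k := ℂ
  hasPrimitiveRoot := ⟨Complex.exp (2 * Real.pi * Complex.I / (4 * 3 : ℕ)),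
    Complex.isPrimitiveRoot_exp (4 * 3) (by decide)⟩
  PiX := TopGroup.of (Multiplicative (ZMod 1))
  Gk := TopGroup.of (Multiplicative (ZMod 1))
  aug := 1
  aug_continuous := continuous_of_discreteTopology
  aug_surjective := fun _ => ⟨1, Subsingleton.elim _ _⟩
  modelPi := TopGroup.of (Multiplicative (ZMod 1))
  modelD := ⊤
  modelD_inn := le_top
  modelD_continuous := fun _ _ => ⟨continuous_of_discreteTopology, continuous_of_discreteTopology⟩
  modelTheta := ∅

/-- In the point toy F-0421 FAILS for EVERY candidate radial functor `Q` (`G` is trivial: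
`not_quotientFunctor_not_full_of_subsingleton`, p428047). [claim: Mochizuki2012, status: disputed]
(IUTchII §1 Ex 1.9 (iii), kurims p.43) -/
theorem not_quotientFunctor_not_full_point (Q : IsoClass pointSetting.PiX ⥤ IsoClass pointSetting.Gk) :
    ¬ Literature.IUT.HodgeArakelov.quotientFunctor_not_full pointSetting Q :=
  haveI : Subsingleton pointSetting.Gk :=
    ⟨fun a b => congrArg ofAdd (Subsingleton.elim (toAdd a) (toAdd b))⟩
  not_quotientFunctor_not_full_of_subsingleton pointSetting Q

/-! ## 4. Independence -/

/-- **F-0421 is INDEPENDENT of the typed interfaces**: the named input "`Φ` fails to be full" of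
[IUTchII] Ex. 1.9 (iii) holds at the genuine quotient functor of one inhabited `ThetaSetting`/`AbsTopMonoids`
(the lift toy) and fails for every functor at another (the point toy). So it is a genuine, consistent
hypothesis — exactly the cited [AbsTopIII] §I3 / Rmk 1.9.4 / Rmk 1.9.1 content, consumed BY NAME by the node.
[claim: Mochizuki2012, status: disputed] (IUTchII §1 Ex 1.9 (iii), kurims pp.42-43) -/
theorem quotientFunctor_not_full_independent :
    (∃ (S : ThetaSetting.{0}) (A : AbsTopMonoids S),
        Literature.IUT.HodgeArakelov.quotientFunctor_not_full S A.quotFunctor) ∧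
      ∃ S : ThetaSetting.{0}, ∀ Q : IsoClass S.PiX ⥤ IsoClass S.Gk,
        ¬ Literature.IUT.HodgeArakelov.quotientFunctor_not_full S Q :=
  ⟨⟨liftSetting, liftMonoids, quotientFunctor_not_full_lift⟩,
    ⟨pointSetting, not_quotientFunctor_not_full_point⟩⟩

end Ex19iiiToy

end Literature.IUT.HodgeArakelov
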